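/- Width seat `ym-line-cbag-p1-w2` (prover-ym-line-cbag-p1-w2-g15-0; own items stmt-QuantumFields-22254 / 22893 CLOSED) on the
planner-of-record's LINE 4, route `U1DipoleHelicity`, crux `WilsonU1DipoleLawD4` (stmt-QuantumFields-25880): the route-posited free
photon kernel `freeK` of the crux (the `let K` of the route decls) IS the tree's lattice-Maxwell two-plaquette kernel
`curvatureTwoPoint` between the `(0,1)`-plaquettes at `0` and `z`.  Helper `--supports stmt-QuantumFields-25880`; no stub is closed
here.  Nothing in this file bears on the Yang–Mills mass gap. -/
import Summits.QuantumFields.YangMills.Theorems.U1DipoleHelicityWilsonU1DipoleLawD4Defs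
import Literature.MathematicalPhysics.QuantumFieldTheory.CurvatureGaussianField
import Literature.Probability.LatticeModels.LatticeGreenRiemannSum
import HarnessLib

/-!
# Crux `WilsonU1DipoleLawD4` (stmt-QuantumFields-25880): `freeK = curvatureTwoPoint` (the free photon kernel is the tree's
# lattice-Maxwell field-strength kernel)

The crux and both registered stubs of its skeleton measure the Wilson / Villain two-plaquette functions against the kernel
`freeK z = (2π)⁻⁴ ∫_{[-π,π]⁴} cos(k·z) (k̂₀² + k̂₁²)/Σ_μ k̂_μ² dk`, `k̂_μ = 2 sin(k_μ/2)`, inlined in the route file as a `let`.  This file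
identifies it with the tree's standard object:

* `curvatureTwoPoint_zeroOne_eq_latticeGreen`: `curvatureTwoPoint ⟨0,(0,1)⟩ ⟨z,(0,1)⟩ = ½ Σ_{μ=0,1} (2G(z) − G(z+e_μ) − G(z−e_μ))`,
  `G = latticeGreen` (expansion of the double curl `d (-Δ)⁻¹ d*` of the edge Green kernel `[i=j]·G(x−y)/2`, `G` even);
* `two_latticeGreen_sub_sub_eq_integral`: `2G(z) − G(z+e_μ) − G(z−e_μ) = (2π)⁻⁴ ∫ cos(k·z)·2(1−cos k_μ)/ε(k) dk`
  (`latticeGreen_eq`, `cos(a+b)+cos(a−b) = 2cos a cos b`, integrability of the Green integrand in `d = 4`);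
* **`freeK_eq_curvatureTwoPoint`**: `freeK z = curvatureTwoPoint (d := 4) ⟨0,(0,1)⟩ ⟨z,(0,1)⟩` for every `z ∈ ℤ⁴`
  (`k̂_μ² = 2(1 − cos k_μ)`, `Σ_μ k̂_μ² = 2ε(k)`).

Consequently everything the tree knows about `curvatureTwoPoint` in `d = 4` (positive semidefiniteness, stationarity, the dipole
decay and difference bounds of `Theorems/HankelDensitySplittingLogWindowMixedDominanceKernelDecay.lean`, the box-kernel comparisons of the
`ColdBoxAllGroups` line) applies verbatim to the crux's `freeK`.  RECORD-type material on an abelian comparison line; the Yang–Mills mass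
gap is NOT proved by anything here.
-/

set_option autoImplicit false

noncomputable section

namespace Summit.QuantumFields.YangMills.Theorems.U1DipoleHelicity

open MeasureTheory Finset
open scoped Real
open Literature.Probability.LatticeModels Literature.MathematicalPhysics.QuantumFieldTheory
open Literature.MathematicalPhysics.QuantumLattice (ZdPlaquette)

/-! ### The double curl of the edge Green kernel between two `(0,1)`-plaquettes -/

/-- `G(a − b) = G(b − a)` for the (even) lattice Green function. [folklore] -/
theorem latticeGreen_sub_comm (a b : Literature.Probability.LatticeModels.Site 4) :
    latticeGreen (a - b) = latticeGreen (b - a) := by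
  rw [← Literature.MathematicalPhysics.QuantumFieldTheory.latticeGreen_neg, neg_sub]

/-- **Expansion of the double curl**: `curvatureTwoPoint ⟨0,(0,1)⟩ ⟨z,(0,1)⟩ = ½ Σ_{μ=0,1} (2G(z) − G(z+e_μ) − G(z−e_μ))`, `G = latticeGreen`
(of the sixteen edge pairs only the eight equal-direction ones contribute, `edgeGreen = [i=j]·G/2`). [folklore] -/
theorem curvatureTwoPoint_zeroOne_eq_latticeGreen (z : Literature.Probability.LatticeModels.Site 4) :
    curvatureTwoPoint (d := 4) ⟨0, ⟨((0 : Fin 4), (1 : Fin 4)), by decide⟩⟩ ⟨z, ⟨((0 : Fin 4), (1 : Fin 4)), by decide⟩⟩ =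
      1 / 2 * ((2 * latticeGreen z - latticeGreen (z + Pi.single 0 1) - latticeGreen (z - Pi.single 0 1)) +
        (2 * latticeGreen z - latticeGreen (z + Pi.single 1 1) - latticeGreen (z - Pi.single 1 1))) := by
  rw [curvatureTwoPoint_eq_plaquetteCurl, plaquetteCurl_eq]
  simp only [plaquetteCurl_eq, edgeGreen_apply]
  have h01 : ((0 : Fin 4) = 1) = False := by decide
  have h10 : ((1 : Fin 4) = 0) = False := by decide
  simp only [h01, h10, if_true, if_false]
  -- site arithmetic
  have e1 : (0 : Literature.Probability.LatticeModels.Site 4) - z = -z := zero_sub z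
  have e2 : (0 : Literature.Probability.LatticeModels.Site 4) - (z + Pi.single 1 1) = -(z + Pi.single 1 1) := zero_sub _
  have e3 : (0 : Literature.Probability.LatticeModels.Site 4) + Pi.single 0 1 - (z + Pi.single 0 1) = -z := by abel
  have e4 : (0 : Literature.Probability.LatticeModels.Site 4) + Pi.single 0 1 - z = -(z - Pi.single 0 1) := by abel
  have e5 : (0 : Literature.Probability.LatticeModels.Site 4) + Pi.single 1 1 - z = -(z - Pi.single 1 1) := by abel
  have e6 : (0 : Literature.Probability.LatticeModels.Site 4) + Pi.single 1 1 - (z + Pi.single 1 1) = -z := by abel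
  have e7 : (0 : Literature.Probability.LatticeModels.Site 4) - (z + Pi.single 0 1) = -(z + Pi.single 0 1) := zero_sub _
  rw [e1, e2, e3, e4, e5, e6, e7]
  simp only [Literature.MathematicalPhysics.QuantumFieldTheory.latticeGreen_neg]
  ring

/-! ### The second differences of the lattice Green function as Fourier integrals -/

/-- `k·(z + s e_μ) = k·z + s k_μ`. [folklore] -/
theorem sum_mul_intCast_add_single (k : Fin 4 → ℝ) (z : Literature.Probability.LatticeModels.Site 4) (μ : Fin 4) (s : ℤ) :
    ∑ i, k i * (((z + (Pi.single μ s : Literature.Probability.LatticeModels.Site 4)) i : ℤ) : ℝ) =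
      ∑ i, k i * ((z i : ℤ) : ℝ) + (s : ℝ) * k μ := by
  have h : ∀ i, k i * (((z + (Pi.single μ s : Literature.Probability.LatticeModels.Site 4)) i : ℤ) : ℝ) =
      k i * ((z i : ℤ) : ℝ) + k i * (((Pi.single μ s : Literature.Probability.LatticeModels.Site 4) i : ℤ) : ℝ) := by
    intro i
    rw [Pi.add_apply, Int.cast_add, mul_add]
  simp_rw [h]
  rw [Finset.sum_add_distrib]
  congr 1
  rw [Finset.sum_eq_single μ (fun i _ hi => by rw [Pi.single_eq_of_ne hi, Int.cast_zero, mul_zero])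
    (fun h => absurd (Finset.mem_univ μ) h), Pi.single_eq_same, mul_comm]

/-- Pointwise: `2h_z − h_{z+e_μ} − h_{z−e_μ} = cos(k·z)·2(1 − cos k_μ)/ε(k)` for the Green integrand `h_y(k) = cos(k·y)/ε(k)`.
[folklore] -/
theorem two_greenIntegrand_sub_sub (z : Literature.Probability.LatticeModels.Site 4) (μ : Fin 4) (k : Fin 4 → ℝ) :
    2 * greenIntegrand z k - greenIntegrand (z + Pi.single μ 1) k - greenIntegrand (z - Pi.single μ 1) k =
      Real.cos (∑ i, k i * ((z i : ℤ) : ℝ)) * (2 * (1 - Real.cos (k μ))) / dispersion k := by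
  have hsub : z - Pi.single μ 1 = z + (Pi.single μ (-1) : Literature.Probability.LatticeModels.Site 4) := by
    rw [sub_eq_add_neg, ← Pi.single_neg]
  have hplus : ∑ i, k i * (((z + (Pi.single μ 1 : Literature.Probability.LatticeModels.Site 4)) i : ℤ) : ℝ) =
      ∑ i, k i * ((z i : ℤ) : ℝ) + k μ := by
    rw [sum_mul_intCast_add_single, Int.cast_one, one_mul]
  have hminus : ∑ i, k i * (((z + (Pi.single μ (-1) : Literature.Probability.LatticeModels.Site 4)) i : ℤ) : ℝ) =
      ∑ i, k i * ((z i : ℤ) : ℝ) - k μ := by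
    rw [sum_mul_intCast_add_single, Int.cast_neg, Int.cast_one, neg_one_mul, sub_eq_add_neg]
  rw [hsub]
  unfold greenIntegrand
  rw [hplus, hminus, Real.cos_add, Real.cos_sub]
  simp only [div_eq_mul_inv]
  ring

/-- **Second differences of the Green function in Fourier form**: for `μ < 4`,
`2G(z) − G(z+e_μ) − G(z−e_μ) = (∫_{[-π,π]⁴} cos(k·z)·2(1 − cos k_μ)/ε(k) dk)/(2π)⁴. [folklore] -/
theorem two_latticeGreen_sub_sub_eq_integral (z : Literature.Probability.LatticeModels.Site 4) (μ : Fin 4) :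
    2 * latticeGreen z - latticeGreen (z + Pi.single μ 1) - latticeGreen (z - Pi.single μ 1) =
      (∫ k in brillouin 4, Real.cos (∑ i, k i * ((z i : ℤ) : ℝ)) * (2 * (1 - Real.cos (k μ))) / dispersion k) / (2 * π) ^ 4 := by
  have h4 : (3 : ℕ) ≤ 4 := by norm_num
  have hi0 : Integrable (fun k => greenIntegrand z k) (volume.restrict (brillouin 4)) :=
    integrableOn_greenIntegrand 4 h4 z
  have hi1 : Integrable (fun k => greenIntegrand (z + Pi.single μ 1) k) (volume.restrict (brillouin 4)) :=
    integrableOn_greenIntegrand 4 h4 (z + Pi.single μ 1)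
  have hi2 : Integrable (fun k => greenIntegrand (z - Pi.single μ 1) k) (volume.restrict (brillouin 4)) :=
    integrableOn_greenIntegrand 4 h4 (z - Pi.single μ 1)
  have hi02 : Integrable (fun k => 2 * greenIntegrand z k) (volume.restrict (brillouin 4)) := hi0.const_mul 2
  have hi021 : Integrable (fun k => 2 * greenIntegrand z k - greenIntegrand (z + Pi.single μ 1) k)
      (volume.restrict (brillouin 4)) := hi02.sub hi1
  have key : (∫ k in brillouin 4, Real.cos (∑ i, k i * ((z i : ℤ) : ℝ)) * (2 * (1 - Real.cos (k μ))) / dispersion k) =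
      ∫ k in brillouin 4, (2 * greenIntegrand z k - greenIntegrand (z + Pi.single μ 1) k - greenIntegrand (z - Pi.single μ 1) k) :=
    integral_congr_ae (Filter.Eventually.of_forall fun k => (two_greenIntegrand_sub_sub z μ k).symm)
  rw [key, integral_sub hi021 hi2, integral_sub hi02 hi1, integral_const_mul, latticeGreen_eq, latticeGreen_eq, latticeGreen_eq]
  ring

/-! ### `freeK = curvatureTwoPoint` -/

/-- `(2 sin(x/2))² = 2(1 − cos x)`. [folklore] -/
theorem two_mul_sin_half_sq (x : ℝ) : (2 * Real.sin (x / 2)) ^ 2 = 2 * (1 - Real.cos x) := by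
  rw [mul_pow, Real.sin_sq_eq_half_sub, show 2 * (x / 2) = x by ring]
  ring

/-- The integrand of `freeK` is the symmetrised second-difference Green integrand:
`cos(k·z)·(k̂₀² + k̂₁²)/Σ_μ k̂_μ² = ½ Σ_{μ=0,1} cos(k·z)·2(1−cos k_μ)/ε(k)`. [folklore] -/
theorem freeK_integrand_eq (z : Literature.Probability.LatticeModels.Site 4) (k : Fin 4 → ℝ) :
    Real.cos (∑ i : Fin 4, k i * (z i : ℝ)) *
        (((2 * Real.sin (k 0 / 2)) ^ 2 + (2 * Real.sin (k 1 / 2)) ^ 2) / (∑ i : Fin 4, (2 * Real.sin (k i / 2)) ^ 2)) =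
      1 / 2 * (Real.cos (∑ i, k i * ((z i : ℤ) : ℝ)) * (2 * (1 - Real.cos (k 0))) / dispersion k +
        Real.cos (∑ i, k i * ((z i : ℤ) : ℝ)) * (2 * (1 - Real.cos (k 1))) / dispersion k) := by
  simp only [two_mul_sin_half_sq]
  have hden : ∑ i : Fin 4, 2 * (1 - Real.cos (k i)) = 2 * dispersion k := by
    rw [dispersion, Finset.mul_sum]
  rw [hden]
  simp only [div_eq_mul_inv, mul_inv_rev]
  ring

/-- **`freeK = curvatureTwoPoint`**: the route-posited free photon kernel of the field strength `F₀₁` (crux 25880, both stubs) is the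
tree's lattice-Maxwell two-plaquette kernel between the `(0,1)`-plaquettes at `0` and at `z`:
`freeK z = curvatureTwoPoint ⟨0,(0,1)⟩ ⟨z,(0,1)⟩` for every `z ∈ ℤ⁴`. [folklore] -/
theorem freeK_eq_curvatureTwoPoint (z : Literature.Probability.LatticeModels.Site 4) :
    freeK z = curvatureTwoPoint (d := 4) ⟨0, ⟨((0 : Fin 4), (1 : Fin 4)), by decide⟩⟩ ⟨z, ⟨((0 : Fin 4), (1 : Fin 4)), by decide⟩⟩ := by
  have h4 : (3 : ℕ) ≤ 4 := by norm_num
  rw [curvatureTwoPoint_zeroOne_eq_latticeGreen, two_latticeGreen_sub_sub_eq_integral, two_latticeGreen_sub_sub_eq_integral]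
  -- integrability of the two second-difference integrands (as combinations of Green integrands)
  have hint : ∀ μ : Fin 4, Integrable (fun k : Fin 4 → ℝ =>
      Real.cos (∑ i, k i * ((z i : ℤ) : ℝ)) * (2 * (1 - Real.cos (k μ))) / dispersion k) (volume.restrict (brillouin 4)) := by
    intro μ
    have hi0 : Integrable (fun k => greenIntegrand z k) (volume.restrict (brillouin 4)) :=
      integrableOn_greenIntegrand 4 h4 z
    have hi1 : Integrable (fun k => greenIntegrand (z + Pi.single μ 1) k) (volume.restrict (brillouin 4)) :=
      integrableOn_greenIntegrand 4 h4 (z + Pi.single μ 1)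
    have hi2 : Integrable (fun k => greenIntegrand (z - Pi.single μ 1) k) (volume.restrict (brillouin 4)) :=
      integrableOn_greenIntegrand 4 h4 (z - Pi.single μ 1)
    have h3 : Integrable (fun k => 2 * greenIntegrand z k - greenIntegrand (z + Pi.single μ 1) k -
        greenIntegrand (z - Pi.single μ 1) k) (volume.restrict (brillouin 4)) := ((hi0.const_mul 2).sub hi1).sub hi2
    exact h3.congr (Filter.Eventually.of_forall fun k => two_greenIntegrand_sub_sub z μ k)
  unfold freeK
  rw [show Set.pi Set.univ (fun _ : Fin 4 => Set.Icc (-Real.pi) Real.pi) = brillouin 4 from rfl]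
  rw [integral_congr_ae (Filter.Eventually.of_forall fun k => freeK_integrand_eq z k)]
  rw [integral_const_mul, integral_add (hint 0) (hint 1)]
  ring

end Summit.QuantumFields.YangMills.Theorems.U1DipoleHelicity

end
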